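import Summits.KontsevichZagierPeriods.KontsevichZagierPeriods.Theorems.LinRedNormalFormArrangementNormalFormSeparateTwoHILocal
import Summits.KontsevichZagierPeriods.KontsevichZagierPeriods.Theorems.LinRedNormalFormArrangementNormalFormSeparateTwoMeas

/-!
# Termwise absolute convergence of the planar Taylor split (`stub_separateTwoPos_hI`)

(Line `janus-bands`, crux `ArrangementNormalForm`, stub `stub_separateTwoPos_hI`, part `Final`.)
Base dimension `2` (`b = 1`: base `(x, y)`), `k` fibres. A terminal piece of the far-first
separation engine carries `P(x,y)/∏ L_j(x)^{e_j} · (y − ℓ(x))^{-n} · (fibre block)` on a bounded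
`polygon × fibre cell`, absolutely convergent, with the wall invariant `hH` (an active `x`-letter
vanishes on the closed domain only on the pole line). CLAIM (`stub_separateTwoPos_hI`): every
Taylor piece `q_i(x) (y − ℓ)^{i−n}/∏ L_j^{e_j} · (fibre block)` is absolutely integrable on the
domain. Proof: the Tonelli dictionary of parts `Mass`/`Meas` turns both the hypothesis and the
claim into statements about base integrals against the fibre mass `lmass`; the claim is local on
the compact closure of the domain (`SepTwoZero.integrableOn_of_forall_nhds`), and at a point `z₀`
of the closure the local theorem `SepTwo.local_finite` of part `HILocal` (thin sectors, ray
theorems, covering lemma) applies at the base point of `z₀`, where `hH` supplies its hypothesis.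
Degenerate letters (`L_j ≡ 0` active) make every piece vanish identically.
-/

noncomputable section

open Set MeasureTheory Filter Topology
open scoped ENNReal

namespace Summit.KontsevichZagierPeriods.ArrangementNormalForm.JanusBands

open Literature.NumberTheory.Transcendental

namespace SepTwo

open Literature.ModelTheory.ExponentialFields

/-! ### Reading the literal base factors in the coordinates `x 0`, `x 1` -/

/-- An `x`-form over a one-dimensional `x`. -/
theorem fin1_aff (c : (Fin 1 → ℚ) × ℚ) (x : Fin (1 + 1) → ℝ) :
    (∑ i, (c.1 i : ℝ) * x (Fin.castSucc i) + (c.2 : ℝ)) = (c.1 0 : ℝ) * x 0 + c.2 := by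
  rw [Fin.sum_univ_one]; rfl

/-- An `x`-form over a one-dimensional `x`, read on `ℝ^{2+k}`. -/
theorem fin1_affz {k : ℕ} (c : (Fin 1 → ℚ) × ℚ) (z : Fin (1 + 1 + k) → ℝ) :
    (∑ i, (c.1 i : ℝ) * z (Fin.castAdd k (Fin.castSucc i)) + (c.2 : ℝ)) =
      (c.1 0 : ℝ) * z (Fin.castAdd k 0) + c.2 := by
  rw [Fin.sum_univ_one]; rfl

/-- The `x`-part of a base point over a one-dimensional `x`. -/
theorem fin1_fun (x : Fin (1 + 1) → ℝ) : (fun i : Fin 1 => x (Fin.castSucc i)) = fun _ => x 0 := by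
  funext i; rw [Fin.eq_zero i]; rfl

/-- The literal base factor of the integrand in nice form. -/
theorem baseR_eq {m : ℕ} (L : Fin m → (Fin 1 → ℚ) × ℚ) (e : Fin m → ℕ)
    (p : MvPolynomial (Fin (1 + 1)) ℚ) (ℓ : (Fin 1 → ℚ) × ℚ) (n N : ℕ)
    (q : ℕ → MvPolynomial (Fin 1) ℚ)
    (hq : ∀ x : Fin (1 + 1) → ℝ, MvPolynomial.aeval x p = ∑ i ∈ Finset.range N,
      MvPolynomial.aeval (fun i => x (Fin.castSucc i)) (q i) *
        (x (Fin.last 1) - (∑ i, (ℓ.1 i : ℝ) * x (Fin.castSucc i) + (ℓ.2 : ℝ))) ^ i)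
    (x : Fin (1 + 1) → ℝ) :
    MvPolynomial.aeval x p / (∏ j, (∑ i, ((L j).1 i : ℝ) * x (Fin.castSucc i) + ((L j).2 : ℝ)) ^ e j) *
        (1 / (x (Fin.last 1) - (∑ i, (ℓ.1 i : ℝ) * x (Fin.castSucc i) + (ℓ.2 : ℝ))) ^ n) =
      (∑ i ∈ Finset.range N, MvPolynomial.aeval (fun _ : Fin 1 => x 0) (q i) *
        (x 1 - ((ℓ.1 0 : ℝ) * x 0 + ℓ.2)) ^ i) /
        ((∏ j, (((L j).1 0 : ℝ) * x 0 + (L j).2) ^ e j) * (x 1 - ((ℓ.1 0 : ℝ) * x 0 + ℓ.2)) ^ n) := by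
  rw [hq x]
  simp only [fin1_aff, fin1_fun]
  rw [one_div, ← div_eq_mul_inv, div_div]
  rfl

/-- The literal base factor of a Taylor piece in nice form. -/
theorem baseRi_eq {m : ℕ} (L : Fin m → (Fin 1 → ℚ) × ℚ) (e : Fin m → ℕ) (ℓ : (Fin 1 → ℚ) × ℚ)
    (n : ℕ) (qi : MvPolynomial (Fin 1) ℚ) (i : ℕ) (x : Fin (1 + 1) → ℝ) :
    MvPolynomial.aeval (fun i => x (Fin.castSucc i)) qi /
        (∏ j, (∑ i, ((L j).1 i : ℝ) * x (Fin.castSucc i) + ((L j).2 : ℝ)) ^ e j) *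
        ((x (Fin.last 1) - (∑ i, (ℓ.1 i : ℝ) * x (Fin.castSucc i) + (ℓ.2 : ℝ))) ^ i /
          (x (Fin.last 1) - (∑ i, (ℓ.1 i : ℝ) * x (Fin.castSucc i) + (ℓ.2 : ℝ))) ^ n) =
      MvPolynomial.aeval (fun _ : Fin 1 => x 0) qi * (x 1 - ((ℓ.1 0 : ℝ) * x 0 + ℓ.2)) ^ i /
        ((∏ j, (((L j).1 0 : ℝ) * x 0 + (L j).2) ^ e j) * (x 1 - ((ℓ.1 0 : ℝ) * x 0 + ℓ.2)) ^ n) := by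
  simp only [fin1_aff, fin1_fun]
  rw [div_mul_div_comm]
  rfl

/-- The literal base factor of the integrand is measurable. -/
theorem measurable_baseR {m : ℕ} (L : Fin m → (Fin 1 → ℚ) × ℚ) (e : Fin m → ℕ)
    (p : MvPolynomial (Fin (1 + 1)) ℚ) (ℓ : (Fin 1 → ℚ) × ℚ) (n : ℕ) :
    Measurable fun x : Fin (1 + 1) → ℝ => MvPolynomial.aeval x p /
      (∏ j, (∑ i, ((L j).1 i : ℝ) * x (Fin.castSucc i) + ((L j).2 : ℝ)) ^ e j) *
      (1 / (x (Fin.last 1) - (∑ i, (ℓ.1 i : ℝ) * x (Fin.castSucc i) + (ℓ.2 : ℝ))) ^ n) := by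
  refine ((measurable_aeval_real p).div ?_).mul ?_
  · refine Finset.measurable_prod _ fun j _ => Measurable.pow_const ?_ _
    refine Measurable.add_const (Finset.measurable_sum _ fun i _ => ?_) _
    exact (measurable_pi_apply _).const_mul _
  · refine Measurable.const_div (Measurable.pow_const ?_ _) _
    refine (measurable_pi_apply _).sub (Measurable.add_const (Finset.measurable_sum _ fun i _ => ?_) _)
    exact (measurable_pi_apply _).const_mul _

/-- The literal base factor of a Taylor piece is measurable. -/
theorem measurable_baseRi {m : ℕ} (L : Fin m → (Fin 1 → ℚ) × ℚ) (e : Fin m → ℕ)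
    (ℓ : (Fin 1 → ℚ) × ℚ) (n : ℕ) (qi : MvPolynomial (Fin 1) ℚ) (i : ℕ) :
    Measurable fun x : Fin (1 + 1) → ℝ => MvPolynomial.aeval (fun i => x (Fin.castSucc i)) qi /
      (∏ j, (∑ i, ((L j).1 i : ℝ) * x (Fin.castSucc i) + ((L j).2 : ℝ)) ^ e j) *
      ((x (Fin.last 1) - (∑ i, (ℓ.1 i : ℝ) * x (Fin.castSucc i) + (ℓ.2 : ℝ))) ^ i /
        (x (Fin.last 1) - (∑ i, (ℓ.1 i : ℝ) * x (Fin.castSucc i) + (ℓ.2 : ℝ))) ^ n) := by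
  have hlam : Measurable fun x : Fin (1 + 1) → ℝ =>
      x (Fin.last 1) - (∑ i, (ℓ.1 i : ℝ) * x (Fin.castSucc i) + (ℓ.2 : ℝ)) := by
    refine (measurable_pi_apply _).sub (Measurable.add_const (Finset.measurable_sum _ fun i _ => ?_) _)
    exact (measurable_pi_apply _).const_mul _
  refine (Measurable.div ?_ ?_).mul ((hlam.pow_const _).div (hlam.pow_const _))
  · exact (measurable_aeval_real qi).comp (measurable_pi_lambda _ fun i => measurable_pi_apply _)
  · refine Finset.measurable_prod _ fun j _ => Measurable.pow_const ?_ _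
    refine Measurable.add_const (Finset.measurable_sum _ fun i _ => ?_) _
    exact (measurable_pi_apply _).const_mul _

end SepTwo

/-! ### The stub -/

open SepTwo in
/-- **Termwise absolute convergence of the planar Taylor split** (`stub_separateTwoPos_hI` of the
line `janus-bands`): see the module docstring. -/
theorem stub_separateTwoPos_hI (b k m m' n : ℕ) (s : KZ.IntegralRep (b + 1 + k)) (M : Fin m' → (Fin (b + 1) → ℚ) × ℚ) (L : Fin m → (Fin b → ℚ) × ℚ) (e : Fin m → ℕ) (p : MvPolynomial (Fin (b + 1)) ℚ) (ℓ : (Fin b → ℚ) × ℚ) (a : Fin k → Option ((Fin (b + 1) → ℚ) × ℚ)) (lo hi : Fin k → Fin k ⊕ ((Fin (b + 1) → ℚ) × ℚ)) (hpole : n ≠ 0 → ∀ z ∈ s.domain, (z (Fin.castAdd k (Fin.last b)) - (∑ i, (ℓ.1 i : ℝ) * z (Fin.castAdd k (Fin.castSucc i)) + (ℓ.2 : ℝ))) ≠ 0) (hbd : Bornology.IsBounded s.domain) (hdom : s.domain = {z | (∀ j, 0 < ∑ i, ((M j).1 i : ℝ) * z (Fin.castAdd k i) + ((M j).2 : ℝ))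 ∧ ∀ i, Sum.elim (fun j => z (Fin.natAdd (b + 1) j)) (fun c => ∑ i', (c.1 i' : ℝ) * z (Fin.castAdd k i') + (c.2 : ℝ)) (lo i) < z (Fin.natAdd (b + 1) i) ∧ z (Fin.natAdd (b + 1) i) < Sum.elim (fun j => z (Fin.natAdd (b + 1) j)) (fun c => ∑ i', (c.1 i' : ℝ) * z (Fin.castAdd k i') + (c.2 : ℝ)) (hi i)}) (hint : EqOn s.integrand (fun z => MvPolynomial.aeval (fun i => z (Fin.castAdd k i)) p / (∏ j, (∑ i, ((L j).1 i : ℝ) * z (Fin.castAdd k (Fin.castSucc i)) + ((L j).2 : ℝ)) ^ e j) * (1 / (z (Fin.castAdd k (Fin.last b)) - (∑ i, (ℓ.1 i : ℝ) * z (Fin.castAdd k (Fin.castSucc i)) + (ℓ.2 : ℝ))) ^ n) * ∏ i, (a i).elim 1 (fun c => 1 / (z (Fin.natAdd (b + 1) i) - (∑ i', (c.1 i' : ℝ) * z (Fin.castAdd k i') + (c.2 : ℝ))))) s.domain) (N : ℕ) (q : ℕ → MvPolynomial (Fin b) ℚ) (hq : ∀ z : Fin (b + 1 + k) → ℝ,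 MvPolynomial.aeval (fun i => z (Fin.castAdd k i)) p = ∑ i ∈ Finset.range N, MvPolynomial.aeval (fun i => z (Fin.castAdd k (Fin.castSucc i))) (q i) * (z (Fin.castAdd k (Fin.last b)) - (∑ i, (ℓ.1 i : ℝ) * z (Fin.castAdd k (Fin.castSucc i)) + (ℓ.2 : ℝ))) ^ i) (hb : b = 1) (hH : ∀ j, e j ≠ 0 → ∀ z ∈ closure s.domain, (∑ i, ((L j).1 i : ℝ) * z (Fin.castAdd k (Fin.castSucc i)) + ((L j).2 : ℝ)) = 0 → (n ≠ 0 ∧ z (Fin.castAdd k (Fin.last b)) = ∑ i, (ℓ.1 i : ℝ) * z (Fin.castAdd k (Fin.castSucc i)) + (ℓ.2 : ℝ))) : ∀ i ∈ Finset.range N, IntegrableOn (fun z => MvPolynomial.aeval (fun i => z (Fin.castAdd k (Fin.castSucc i))) (q i) / (∏ j, (∑ i, ((L j).1 i : ℝ) * z (Fin.castAdd k (Fin.castSucc i)) + ((L j).2 : ℝ)) ^ e j) * ((z (Fin.castAdd k (Fin.last b)) - (∑ i, (ℓ.1 i : ℝ) * z (Fin.castAdd k (Fin.castSucc i)) + (ℓ.2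 : ℝ))) ^ i / (z (Fin.castAdd k (Fin.last b)) - (∑ i, (ℓ.1 i : ℝ) * z (Fin.castAdd k (Fin.castSucc i)) + (ℓ.2 : ℝ))) ^ n) * ∏ i, (a i).elim 1 (fun c => 1 / (z (Fin.natAdd (b + 1) i) - (∑ i', (c.1 i' : ℝ) * z (Fin.castAdd k i') + (c.2 : ℝ))))) s.domain := by
  subst hb
  intro i hiN
  classical
  have _hp := hpole
  -- degenerate letters: an active letter that is identically zero kills every piece
  by_cases hdeg : ∃ j, e j ≠ 0 ∧ (L j).1 0 = 0 ∧ (L j).2 = 0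
  · obtain ⟨j, hej, h1, h2⟩ := hdeg
    have h0 : ∀ z : Fin (1 + 1 + k) → ℝ,
        (∏ j, (∑ i, ((L j).1 i : ℝ) * z (Fin.castAdd k (Fin.castSucc i)) + ((L j).2 : ℝ)) ^ e j) = 0 :=
      fun z => Finset.prod_eq_zero (Finset.mem_univ j) (by
        rw [Fin.sum_univ_one, h1, h2]; simp [hej])
    have hf0 : (fun z : Fin (1 + 1 + k) → ℝ => MvPolynomial.aeval (fun i => z (Fin.castAdd k (Fin.castSucc i))) (q i) /
        (∏ j, (∑ i, ((L j).1 i : ℝ) * z (Fin.castAdd k (Fin.castSucc i)) + ((L j).2 : ℝ)) ^ e j) *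
        ((z (Fin.castAdd k (Fin.last 1)) - (∑ i, (ℓ.1 i : ℝ) * z (Fin.castAdd k (Fin.castSucc i)) + (ℓ.2 : ℝ))) ^ i /
          (z (Fin.castAdd k (Fin.last 1)) - (∑ i, (ℓ.1 i : ℝ) * z (Fin.castAdd k (Fin.castSucc i)) + (ℓ.2 : ℝ))) ^ n) *
        ∏ i, (a i).elim 1 (fun c => 1 / (z (Fin.natAdd (1 + 1) i) -
          (∑ i', (c.1 i' : ℝ) * z (Fin.castAdd k i') + (c.2 : ℝ))))) = fun _ => 0 := by
      funext z; rw [h0 z, div_zero, zero_mul, zero_mul]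
    rw [hf0]
    exact integrableOn_zero
  push Not at hdeg
  -- the base data
  set Y : Set (Fin (1 + 1) → ℝ) := {x | ∀ j, 0 < av x (M j)} with hY_def
  have hYm : MeasurableSet Y := measurableSet_Y M
  have hdom' : s.domain = fdom Y lo hi := hdom
  have hqx : ∀ x : Fin (1 + 1) → ℝ, MvPolynomial.aeval x p = ∑ i ∈ Finset.range N,
      MvPolynomial.aeval (fun i => x (Fin.castSucc i)) (q i) *
        (x (Fin.last 1) - (∑ i, (ℓ.1 i : ℝ) * x (Fin.castSucc i) + (ℓ.2 : ℝ))) ^ i := by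
    intro x
    have h := hq (Fin.append x 0)
    simpa only [Fin.append_left] using h
  have hκ : ∀ j, e j ≠ 0 → ((L j).1 0 : ℝ) = 0 → ((L j).2 : ℝ) ≠ 0 := fun j hej h1 h2 =>
    hdeg j hej (by exact_mod_cast h1) (by exact_mod_cast h2)
  -- the global finiteness of the integrand over the base
  have hRm := measurable_baseR L e p ℓ n
  have hfinY : ∫⁻ x in Y, ENNReal.ofReal |MvPolynomial.aeval x p /
      (∏ j, (∑ i, ((L j).1 i : ℝ) * x (Fin.castSucc i) + ((L j).2 : ℝ)) ^ e j) *
      (1 / (x (Fin.last 1) - (∑ i, (ℓ.1 i : ℝ) * x (Fin.castSucc i) + (ℓ.2 : ℝ))) ^ n)| *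
      lmass lo hi a (av x) < ∞ := by
    have hI := s.integrableOn
    rw [hdom'] at hI
    have v1 : ∀ z : Fin (1 + 1 + k) → ℝ, (MvPolynomial.aeval (fun i => z (Fin.castAdd k i)) p /
        (∏ j, (∑ i, ((L j).1 i : ℝ) * z (Fin.castAdd k (Fin.castSucc i)) + ((L j).2 : ℝ)) ^ e j) *
        (1 / (z (Fin.castAdd k (Fin.last 1)) -
          (∑ i, (ℓ.1 i : ℝ) * z (Fin.castAdd k (Fin.castSucc i)) + (ℓ.2 : ℝ))) ^ n)) *
        (∏ i, (a i).elim 1 (fun c => 1 / (z (Fin.natAdd (1 + 1) i) -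
          (∑ i', (c.1 i' : ℝ) * z (Fin.castAdd k i') + (c.2 : ℝ))))) =
      (fun x : Fin (1 + 1) → ℝ => MvPolynomial.aeval x p /
        (∏ j, (∑ i, ((L j).1 i : ℝ) * x (Fin.castSucc i) + ((L j).2 : ℝ)) ^ e j) *
        (1 / (x (Fin.last 1) - (∑ i, (ℓ.1 i : ℝ) * x (Fin.castSucc i) + (ℓ.2 : ℝ))) ^ n)) (basePt z) *
        rblock a z := fun z => rfl
    have hint' : EqOn s.integrand (fun z => (fun x : Fin (1 + 1) → ℝ => MvPolynomial.aeval x p /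
        (∏ j, (∑ i, ((L j).1 i : ℝ) * x (Fin.castSucc i) + ((L j).2 : ℝ)) ^ e j) *
        (1 / (x (Fin.last 1) - (∑ i, (ℓ.1 i : ℝ) * x (Fin.castSucc i) + (ℓ.2 : ℝ))) ^ n)) (basePt z) *
        rblock a z) (fdom Y lo hi) := by
      intro z hz
      rw [← hdom'] at hz
      rw [hint hz]
      exact v1 z
    exact (integrableOn_fdom_iff hYm lo hi a _ hRm s.integrand hint' hI.aestronglyMeasurable).1 hI
  -- local + compact
  refine SepTwoZero.integrableOn_of_forall_nhds hbd.isCompact_closure fun z₀ hz₀ => ?_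
  have hH' : ∀ j, e j ≠ 0 → ((L j).1 0 : ℝ) * basePt z₀ 0 + (L j).2 = 0 →
      basePt z₀ 1 - ((ℓ.1 0 : ℝ) * basePt z₀ 0 + ℓ.2) = 0 := by
    intro j hej h0
    have h := hH j hej z₀ hz₀ (by rw [fin1_affz]; exact h0)
    rw [fin1_affz] at h
    exact sub_eq_zero.2 h.2
  obtain ⟨V, hVo, hVx, hVfin⟩ := local_finite M lo hi a (fun j => ((L j).1 0 : ℝ))
    (fun j => ((L j).2 : ℝ)) e n (ℓ.1 0) ℓ.2 N q
    (fun x : Fin (1 + 1) → ℝ => MvPolynomial.aeval x p /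
      (∏ j, (∑ i, ((L j).1 i : ℝ) * x (Fin.castSucc i) + ((L j).2 : ℝ)) ^ e j) *
      (1 / (x (Fin.last 1) - (∑ i, (ℓ.1 i : ℝ) * x (Fin.castSucc i) + (ℓ.2 : ℝ))) ^ n))
    (fun i (x : Fin (1 + 1) → ℝ) => MvPolynomial.aeval (fun i => x (Fin.castSucc i)) (q i) /
      (∏ j, (∑ i, ((L j).1 i : ℝ) * x (Fin.castSucc i) + ((L j).2 : ℝ)) ^ e j) *
      ((x (Fin.last 1) - (∑ i, (ℓ.1 i : ℝ) * x (Fin.castSucc i) + (ℓ.2 : ℝ))) ^ i /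
        (x (Fin.last 1) - (∑ i, (ℓ.1 i : ℝ) * x (Fin.castSucc i) + (ℓ.2 : ℝ))) ^ n))
    (baseR_eq L e p ℓ n N q hqx) (fun i _ x => baseRi_eq L e ℓ n (q i) i x) hRm
    (fun i => measurable_baseRi L e ℓ n (q i) i) hκ hfinY (basePt z₀) hH'
  refine ⟨basePt ⁻¹' V, hVo.preimage (continuous_pi fun i => continuous_apply _), hVx, ?_⟩
  have hset : s.domain ∩ basePt ⁻¹' V = fdom (Y ∩ V) lo hi := by
    rw [hdom']
    ext z
    simp only [fdom, mem_inter_iff, mem_setOf_eq, mem_preimage]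
    tauto
  rw [hset]
  refine integrableOn_of_lintegral_lt_top (hYm.inter hVo.measurableSet) lo hi a
    (measurable_baseRi L e ℓ n (q i) i) (fun z _ => rfl) ?_
  calc ∫⁻ x in Y ∩ V, ENNReal.ofReal |MvPolynomial.aeval (fun i => x (Fin.castSucc i)) (q i) /
        (∏ j, (∑ i, ((L j).1 i : ℝ) * x (Fin.castSucc i) + ((L j).2 : ℝ)) ^ e j) *
        ((x (Fin.last 1) - (∑ i, (ℓ.1 i : ℝ) * x (Fin.castSucc i) + (ℓ.2 : ℝ))) ^ i /
          (x (Fin.last 1) - (∑ i, (ℓ.1 i : ℝ) * x (Fin.castSucc i) + (ℓ.2 : ℝ))) ^ n)| *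
        lmass lo hi a (av x)
      ≤ ∫⁻ x in Y ∩ V, Y.indicator (fun x => (∑ i' ∈ Finset.range N, ENNReal.ofReal
          |MvPolynomial.aeval (fun i => x (Fin.castSucc i)) (q i') /
            (∏ j, (∑ i, ((L j).1 i : ℝ) * x (Fin.castSucc i) + ((L j).2 : ℝ)) ^ e j) *
            ((x (Fin.last 1) - (∑ i, (ℓ.1 i : ℝ) * x (Fin.castSucc i) + (ℓ.2 : ℝ))) ^ i' /
              (x (Fin.last 1) - (∑ i, (ℓ.1 i : ℝ) * x (Fin.castSucc i) + (ℓ.2 : ℝ))) ^ n)|) *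
          lmass lo hi a (av x)) x := by
        refine setLIntegral_mono' (hYm.inter hVo.measurableSet) fun x hx => ?_
        rw [indicator_of_mem hx.1]
        refine mul_le_mul_left (Finset.single_le_sum (f := fun i' => ENNReal.ofReal
          |MvPolynomial.aeval (fun i => x (Fin.castSucc i)) (q i') /
            (∏ j, (∑ i, ((L j).1 i : ℝ) * x (Fin.castSucc i) + ((L j).2 : ℝ)) ^ e j) *
            ((x (Fin.last 1) - (∑ i, (ℓ.1 i : ℝ) * x (Fin.castSucc i) + (ℓ.2 : ℝ))) ^ i' /
              (x (Fin.last 1) - (∑ i, (ℓ.1 i : ℝ) * x (Fin.castSucc i) + (ℓ.2 : ℝ))) ^ n)|)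
          (fun _ _ => zero_le) hiN) _
    _ ≤ _ := lintegral_mono_set inter_subset_right
    _ < ∞ := hVfin

end Summit.KontsevichZagierPeriods.ArrangementNormalForm.JanusBands
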